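import Summits.BirchSwinnertonDyer.BirchSwinnertonDyer.Theorems.EisensteinPrimesInertiaTorsionFiniteGeneric
import Summits.BirchSwinnertonDyer.Rank1Residual.X2.NonPrimitiveQuotientCorank
import Literature.NumberTheory.EllipticCurves.GreenbergSelmerDualDataExistsProofs
import HarnessLib

/-!
# `corank_{ℤ_p}(S^{S₀}_M(K_∞)/S_M(K_∞)) ≤ Σ_{v∈S₀} N_v · c_v` from PER-PLACE corank bounds, for a
# GENERIC `p`-divisible discrete module `M` (port of b2b X2 `NonPrimitiveQuotientCorank` §2)

Cell `bsd-eis` (home `run/shared/lean/pub/bsd-eis/`), seat `bsd-line-x1-p1-w2` (D-0154 width seat on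
crux 2 `GoodLatticeBDPValue` = stmt-BirchSwinnertonDyer-19032, line `halves` v14, stub
`stub_imprimCorank`): the GLOBAL half of the unconditional `≤`-direction of the two bare
`S`-relaxation corank identities (`KellerYin2024.prop125_residualPair_unrSelmer_corank`,
`rem142_goodLattice_selmerAc_imprimitive`). The b2b theorem
`X2.NonPrimitiveQuotientCorank.zpCorank_quotient_le_sum` is hard-wired to `A = E[p^∞]`; this file is
its port to a GENERIC discrete `Γ_K`-module `M` (`p`-primary with open stabilisers, `p`-divisible,
`M[p]` finite of `p`-power order — the hypotheses of the generic local finiteness theorem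
`InertiaTorsionFiniteGeneric.finite_setOf_nsmul_eq_zero_discreteH1_inertiaIn`, p573188) and ANY
Greenberg data `L`, so that it applies to Keller–Yin's `H¹_{𝓕_nr^{S}}(K_∞, (F/𝒪)(θ)) =
unrSelmer κ (charModule ∅ θ) vbar S = datumSelmerInfty κ _ (bdpData _ p vbar) S`.

HONEST FRAMING: tool theorem only (no definition, no named fact, no `sorry`); any number field, any
`ℤ_p`-extension; closes nothing by itself (`--supports stmt-BirchSwinnertonDyer-19032`); BSD / Mazur's
main conjecture is proved for no curve by this file.

## What

For a number field `K`, a prime `p`, a `ℤ_p`-extension `κ` (`H = ker κ`) and `γ ∈ Γ_K`, a discrete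
`Γ_K`-module `M` as above, ANY Greenberg data `L` above `p`, a finite set `S₀` of places `v ∤ p`,
write `S^{S₀} = datumSelmerInfty κ M L ↑S₀ ⊇ S = datumSelmerInfty κ M L ∅`. Given, at each
`v ∈ S₀`, (a) a number `N_v` with `Γ_K = H · D_v · {γⁿ : n < N_v}` (`hrep`; e.g. b2b
`Iwasawa.exists_forall_eq_mul_decomp_mul_pow`, or the sharp `N_v = numPlacesAbove κ v` of the sequel)
and (b) a bound `c_v` on `zpCorank` of every subgroup of the image of the restriction
`r_v : H¹(H, M) → H¹(H ∩ I_v, M)` (`hloc`), then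

* **`zpCorank_quotient_le_sum`**: `zpCorank (S^{S₀}/S) p ≤ Σ_{v∈S₀} N_v · c_v`.

Proof verbatim as in b2b X2 (the detecting map `Φ = (r_v ∘ conj_{γⁿ})_{v, n<N_v}` has kernel `S` on
`S^{S₀}` by `forall_conjH1_mem_unramifiedKer_of_forall_lt`; `S^{S₀}/S ≅ Φ(S^{S₀}) ↪ ∏_v ∏_{n<N_v}
Y_{v,n}` with `Y_{v,n} ⊆ r_v(H¹(H, M))` `p`-primary with finite `p`-torsion; `zpCorank` is monotone
under injections and additive over finite products), with the two `E[p^∞]`-specific inputs replaced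
by `GreenbergSelmer.exists_pow_smul_subgroupH1_eq_zero` and p573188.

References: Greenberg–Vatsal, Invent. Math. 142 (2000) §2 pp. 16–17, 20–22 (Cor. (2.3),
Prop. (2.4)); Greenberg, LNM 1716 §1 p. 60; Keller–Yin arXiv:2402.12781v2 Prop. 1.2.5.
-/

-- `Summit.BirchSwinnertonDyer.BirchSwinnertonDyer.…`: summit and sub-problem share a name (D-0017 layout).
set_option linter.dupNamespace false
set_option autoImplicit false

noncomputable section

open scoped Classical AddSubgroup

open NumberField IsDedekindDomain Field CategoryTheory
open Literature.NumberTheory.GaloisRepresentations Literature.NumberTheory.EllipticCurves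
  Literature.NumberTheory.EllipticCurves.GreenbergSelmer
  Literature.NumberTheory.EllipticCurves.GreenbergVatsal2000
  Summit.BirchSwinnertonDyer.Rank1Residual.Iwasawa
  Summit.BirchSwinnertonDyer.Rank1Residual.X2.NonPrimitiveQuotientCorank
  Summit.BirchSwinnertonDyer.BirchSwinnertonDyer.Theorems.InertiaTorsionFiniteGeneric

universe u

namespace Summit.BirchSwinnertonDyer.BirchSwinnertonDyer.Theorems.UnrSelmerQuotientCorankLeGeneric

variable {K : Type u} [Field K] [NumberField K] {M : Type u} [AddCommGroup M]
  [DistribMulAction (absoluteGaloisGroup K) M] [TopologicalSpace M] [DiscreteTopology M]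
  {p : ℕ} [Fact p.Prime] (κ : ZpExtension K p) {γ : absoluteGaloisGroup K}

/-- **`zpCorank (S^{S₀}_M(K_∞)/S_M(K_∞)) p ≤ Σ_{v∈S₀} N_v · c_v`** for a GENERIC discrete
`Γ_K`-module `M` (`p`-primary `htor`, open stabilisers `hstab`, `p`-divisible `hdiv`, `M[p]` finite
of `p`-power order `hcard`), ANY Greenberg data `L`, and a finite set `S₀` of places `v ∤ p`,
granted at each `v ∈ S₀`: the representative property `Γ_K = H · D_v · {γⁿ : n < N_v}` (`hrep`) and
a bound `c_v` on the corank formula of every subgroup of the image of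
`r_v : H¹(H, M) → H¹(H ∩ I_v, M)` (`hloc`). The UPPER bound in Greenberg–Vatsal's
`corank S^{Σ₀}_A/S_A = Σ_{ℓ∈Σ₀} corank 𝓗_ℓ` (Cor. (2.3) with Prop. (2.4)), for Keller–Yin's
`H¹_{𝓕_nr^{S}}/H¹_{𝓕_nr}` (Prop. 1.2.5, (eq:Gr to imp)) once instantiated at `(F/𝒪)(θ)`. Port of
b2b `X2.NonPrimitiveQuotientCorank.zpCorank_quotient_le_sum` (same proof, generic inputs).
[cite: GreenbergVatsal2000, §2 pp. 17, 20–22] [cite: KellerYin2024, Prop. 1.2.5 (arXiv:2402.12781v2 TeX L780–800)] -/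
theorem zpCorank_quotient_le_sum [Finite ↥(M[(p : ℤ)])]
    (htor : ∀ m : M, ∃ k : ℕ, p ^ k • m = 0)
    (hcard : ∃ k : ℕ, Nat.card ↥(M[(p : ℤ)]) = p ^ k)
    (hdiv : ∀ m : M, ∃ m' : M, p • m' = m)
    (hstab : ∀ m : M,
      IsOpen (MulAction.stabilizer (absoluteGaloisGroup K) m : Set (absoluteGaloisGroup K)))
    (L : Data K M p)
    (S₀ : Finset (HeightOneSpectrum (𝓞 K))) (hS₀ : ∀ v ∈ S₀, ((p : ℕ) : 𝓞 K) ∉ v.asIdeal)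
    (N c : HeightOneSpectrum (𝓞 K) → ℕ)
    (hrep : ∀ v ∈ S₀, ∀ σ : absoluteGaloisGroup K, ∃ n < N v, ∃ δ ∈ decomp (K := K) v,
      ∃ h ∈ κ.kerSubgroup, σ = h * (δ * γ ^ n))
    (hloc : ∀ v ∈ S₀, ∀ Y : AddSubgroup (discreteH1 (inertiaIn κ.kerSubgroup v) M),
      (∀ y ∈ Y, ∃ x : subgroupH1 κ.kerSubgroup M,
        resH1Hom (inertiaInToH κ.kerSubgroup v) (AddMonoidHom.id M) (fun _ _ ↦ rfl) x = y) →
      zpCorank Y p ≤ c v) :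
    zpCorank (↥(datumSelmerInfty κ M L (↑S₀ : Set (HeightOneSpectrum (𝓞 K)))) ⧸
      (datumSelmerInfty κ M L (∅ : Set (HeightOneSpectrum (𝓞 K)))).addSubgroupOf
        (datumSelmerInfty κ M L (↑S₀ : Set (HeightOneSpectrum (𝓞 K))))) p ≤
      ∑ v ∈ S₀, N v * c v := by
  haveI : κ.kerSubgroup.Normal := by rw [ZpExtension.kerSubgroup]; infer_instance
  set H := κ.kerSubgroup with hH
  set SS := datumSelmerInfty κ M L (↑S₀ : Set (HeightOneSpectrum (𝓞 K))) with hSS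
  set S := datumSelmerInfty κ M L (∅ : Set (HeightOneSpectrum (𝓞 K))) with hS
  let ι := ↥S₀
  -- the detecting map
  let Φ : subgroupH1 H M →+ (Π i : ι, Fin (N i.1) → discreteH1 (inertiaIn H i.1) M) :=
    AddMonoidHom.pi fun i ↦ AddMonoidHom.pi fun n ↦
      (resH1Hom (inertiaInToH H i.1) (AddMonoidHom.id M) fun _ _ ↦ rfl).comp
        (conjH1 H M (γ ^ (n : ℕ)))
  have hΦ : ∀ (x : subgroupH1 H M) (i : ι) (n : Fin (N i.1)),
      Φ x i n = resH1Hom (inertiaInToH H i.1) (AddMonoidHom.id M) (fun _ _ ↦ rfl)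
        (conjH1 H M (γ ^ (n : ℕ)) x) := fun _ _ _ ↦ rfl
  let φ : SS →+ (Π i : ι, Fin (N i.1) → discreteH1 (inertiaIn H i.1) M) := Φ.comp SS.subtype
  -- (a) the kernel of `φ` is `S`
  have hker : ∀ s : SS, φ s = 0 ↔ (s : subgroupH1 H M) ∈ S := by
    intro s
    constructor
    · intro h0
      rw [hS, mem_datumSelmerInfty_empty_iff κ M L (↑S₀ : Set _)]
      refine ⟨s.2, fun v hv hpv σ ↦ ?_⟩
      refine forall_conjH1_mem_unramifiedKer_of_forall_lt κ M
        (hrep v (Finset.mem_coe.1 hv)) (fun n hn ↦ ?_) σ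
      have h := congrFun (congrFun h0 ⟨v, Finset.mem_coe.1 hv⟩) ⟨n, hn⟩
      rw [show φ s ⟨v, Finset.mem_coe.1 hv⟩ ⟨n, hn⟩ = Φ (s : subgroupH1 H M) ⟨v, _⟩ ⟨n, hn⟩
        from rfl, hΦ] at h
      exact h
    · intro hs
      funext i n
      rw [show φ s i n = Φ (s : subgroupH1 H M) i n from rfl, hΦ]
      exact ((mem_datumSelmerInfty_empty_iff κ M L (↑S₀ : Set _) _).1 hs).2 i.1
        (Finset.mem_coe.2 i.2) (hS₀ i.1 i.2) (γ ^ (n : ℕ))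
  have hkerEq : φ.ker = S.addSubgroupOf SS := by
    ext s
    rw [AddMonoidHom.mem_ker, AddSubgroup.mem_addSubgroupOf]
    exact hker s
  -- (b) `SS/S ≅ range φ`
  have hcongr : zpCorank (↥SS ⧸ S.addSubgroupOf SS) p = zpCorank φ.range p := by
    refine zpCorank_congr ?_ p
    exact (QuotientAddGroup.quotientAddEquivOfEq hkerEq).symm.trans
      (QuotientAddGroup.quotientKerEquivRange φ)
  rw [hcongr]
  -- (c) the images `Y_{v,n}` and the product `B`
  let Yv : ∀ i : ι, Fin (N i.1) → AddSubgroup (discreteH1 (inertiaIn H i.1) M) := fun i n ↦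
    (((resH1Hom (inertiaInToH H i.1) (AddMonoidHom.id M) fun _ _ ↦ rfl).comp
      (conjH1 H M (γ ^ (n : ℕ)))).comp SS.subtype).range
  have hYprim : ∀ (i : ι) (n : Fin (N i.1)) (y : Yv i n), ∃ k : ℕ, p ^ k • y = 0 := by
    rintro i n ⟨_, ⟨s, rfl⟩⟩
    obtain ⟨k, hk⟩ := GreenbergSelmer.exists_pow_smul_subgroupH1_eq_zero κ M htor
      (s : subgroupH1 H M)
    refine ⟨k, Subtype.ext ?_⟩
    change p ^ k • ((resH1Hom (inertiaInToH H i.1) (AddMonoidHom.id M) fun _ _ ↦ rfl)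
      (conjH1 H M (γ ^ (n : ℕ)) (s : subgroupH1 H M))) = 0
    rw [← map_nsmul, ← map_nsmul, hk, map_zero, map_zero]
  have hYfin : ∀ (i : ι) (n : Fin (N i.1)), Finite ((↥(Yv i n))[(p : ℤ)]) := by
    intro i n
    have hfin := finite_setOf_nsmul_eq_zero_discreteH1_inertiaIn κ i.1 hcard hdiv hstab
      (hS₀ i.1 i.2)
    haveI := hfin.to_subtype
    refine Finite.of_injective (fun y : (↥(Yv i n))[(p : ℤ)] ↦
      (⟨((y : Yv i n) : discreteH1 (inertiaIn H i.1) M), ?_⟩ :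
        {x : discreteH1 (inertiaIn H i.1) M | p • x = 0})) ?_
    · have h := AddSubgroup.torsionBy.nsmul_iff.1 y.2
      change p • ((y : Yv i n) : discreteH1 (inertiaIn H i.1) M) = 0
      rw [← AddSubmonoidClass.coe_nsmul, h, ZeroMemClass.coe_zero]
    · intro y z hyz
      have h := congrArg Subtype.val hyz
      exact Subtype.ext (Subtype.ext h)
  -- inner and outer products
  have hinner : ∀ i : ι, zpCorank (∀ n : Fin (N i.1), Yv i n) p ≤ N i.1 * c i.1 := by
    intro i
    haveI : ∀ n : Fin (N i.1), Finite ((↥(Yv i n))[(p : ℤ)]) := hYfin i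
    rw [zpCorank_pi (hYprim i)]
    calc ∑ n : Fin (N i.1), zpCorank (Yv i n) p ≤ ∑ _n : Fin (N i.1), c i.1 :=
          Finset.sum_le_sum fun n _ ↦ hloc i.1 i.2 (Yv i n) (by
            rintro _ ⟨s, rfl⟩
            exact ⟨conjH1 H M (γ ^ (n : ℕ)) (s : subgroupH1 H M), rfl⟩)
      _ = N i.1 * c i.1 := by rw [Finset.sum_const, Finset.card_univ, Fintype.card_fin, smul_eq_mul]
  have hBprim : ∀ b : (∀ i : ι, ∀ n : Fin (N i.1), Yv i n), ∃ k : ℕ, p ^ k • b = 0 :=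
    primary_pi fun i ↦ primary_pi (hYprim i)
  haveI hBfin : Finite ((∀ i : ι, ∀ n : Fin (N i.1), Yv i n)[(p : ℤ)]) := by
    haveI : ∀ i : ι, Finite ((∀ n : Fin (N i.1), Yv i n)[(p : ℤ)]) := fun i ↦ by
      haveI : ∀ n : Fin (N i.1), Finite ((↥(Yv i n))[(p : ℤ)]) := hYfin i
      exact finite_torsionBy_pi
    exact finite_torsionBy_pi
  -- (d) `range φ ↪ B`
  let j : φ.range →+ (∀ i : ι, ∀ n : Fin (N i.1), Yv i n) :=
    { toFun := fun y ↦ fun i n ↦ ⟨(y : ∀ i : ι, Fin (N i.1) → discreteH1 (inertiaIn H i.1) M) i n, by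
        obtain ⟨s, hs⟩ := y.2
        exact ⟨s, congrFun (congrFun hs i) n⟩⟩
      map_zero' := by funext i n; rfl
      map_add' := fun y z ↦ by funext i n; rfl }
  have hj : Function.Injective j := by
    intro y z hyz
    apply Subtype.ext
    funext i n
    have h := congrArg (fun f : (∀ i : ι, ∀ n : Fin (N i.1), Yv i n) ↦
      ((f i n : Yv i n) : discreteH1 (inertiaIn H i.1) M)) hyz
    exact h
  calc zpCorank φ.range p ≤ zpCorank (∀ i : ι, ∀ n : Fin (N i.1), Yv i n) p :=
        zpCorank_le_of_injective j hj hBprim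
    _ = ∑ i : ι, zpCorank (∀ n : Fin (N i.1), Yv i n) p := by
        haveI : ∀ i : ι, Finite ((∀ n : Fin (N i.1), Yv i n)[(p : ℤ)]) := fun i ↦ by
          haveI : ∀ n : Fin (N i.1), Finite ((↥(Yv i n))[(p : ℤ)]) := hYfin i
          exact finite_torsionBy_pi
        exact zpCorank_pi fun i ↦ primary_pi (hYprim i)
    _ ≤ ∑ i : ι, N i.1 * c i.1 := Finset.sum_le_sum fun i _ ↦ hinner i
    _ = ∑ v ∈ S₀, N v * c v := Finset.sum_coe_sort S₀ (fun v ↦ N v * c v)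

end Summit.BirchSwinnertonDyer.BirchSwinnertonDyer.Theorems.UnrSelmerQuotientCorankLeGeneric

end
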